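import Mathlib.LinearAlgebra.FreeModule.PID
import Mathlib.LinearAlgebra.Dimension.Constructions
import Mathlib.LinearAlgebra.Dimension.Finite
import Mathlib.Algebra.Module.Torsion.Pi
import Mathlib.Algebra.Polynomial.Inductions
import Mathlib.Algebra.Polynomial.FieldDivision
import Mathlib.RingTheory.Polynomial.Basic
import Literature.Computability.AlgebraicComplexity.BorderRankRestriction
import HarnessLib

/-!
# Border rank is preserved by a suitable one-slice extension (one-step unrestriction)

Topic: `Literature/Computability/AlgebraicComplexity`. The algebraic border rank `algBorderRank`
(`SchoenhageTau.lean`, Bläser 2013, Def. 6.1, over `K[ε]`, any field `K`) of a tensor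
`t ∈ K^{ι × κ × μ}` whose slices `t(a,·,·)` span a subspace `t(A^*) ⊆ K^{κ × μ}` of dimension
`< bR(t)` can be EXTENDED by one new slice `Z ∉ t(A^*)` without increasing the border rank:

* `exists_extendSlice_of_finrank_sliceSpan_lt` — if `dim t(A^*) < bR(t)` then there is
  `Z ∉ t(A^*)` with `bR(t + e_new ⊗ Z) ≤ bR(t)` (hence `=`, `algBorderRank_le_extendSlice`).
  This is the Segre, one-variable step of Jagiełła–Jelisiejew's unrestriction theorem
  (arXiv:2604.24879, Thm. 2.2 with the iterative step Lemma 2.7; the Segre case credited there to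
  Buczyński and to Christandl–Gesmundo–Zuiddam / Chang–Gesmundo–Zuiddam), proved here from first
  principles over `K[ε]`.
* `lt_algBorderRank_of_forall_extendSlice`, `lt_algBorderRank_of_card_lt_of_forall_extendSlice` —
  the contrapositive used by extension-search LOWER-BOUND certificates: if `dim t(A^*) < r ≤ bR(t)`
  (e.g. `|ι| < r`) and EVERY extension by a slice outside `t(A^*)` has border rank `> r`, then
  `bR(t) > r`.
* `algBorderRank_extendSlice_congr_le`, `algBorderRank_extendSlice_congr` — the extension's border
  rank only depends on `Z` modulo `t(A^*)` and up to a non-zero scalar (normalisation of the search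
  space to a complement of `t(A^*)`).

## Proof (module-theoretic form of the "limit `r`-plane" argument)

Take an approximate decomposition `∑_{ρ<r} u_ρ ⊗ v_ρ ⊗ w_ρ = ε^h t + O(ε^{h+1})` with `r = bR(t)`
triads and let `W_ρ = v_ρ ⊗ w_ρ ∈ K[ε]^{κ × μ}`, `M = ⟨W_ρ⟩_{K[ε]}`, `N = {m | ∃ k, ε^k m ∈ M}`
(`satPow`). (1) `linearIndependent_of_isApproxDecomposition`: the `W_ρ` of an OPTIMAL decomposition
are `K[ε]`-linearly independent (a dependency `∑ g_ρ W_ρ = 0`, divided by the largest power of `ε`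
dividing all `g_ρ`, eliminates one triad at the cost of a harmless factor with non-zero constant
term, giving `R_h(t) ≤ r - 1`). (2) `IsApproxDecomposition.extendSlice`: for `m ∈ N` with
`ε^k m = ∑ c_ρ W_ρ`, the `r` triads `(ε^h c_ρ e_new + ε^k u_ρ) ⊗ v_ρ ⊗ w_ρ` are an order-`h+k`
approximate decomposition of `t + e_new ⊗ m(0)`. (3) `le_finrank_of_linearIndependent_of_satPow`:
`N` is a finitely generated torsion-free `K[ε]`-module, hence free (PID), of rank `≥ r`; the
constant terms of a `K[ε]`-basis of `N` are `K`-linearly independent (a `K`-relation among them is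
an element of `N ∩ εK[ε]^{κ×μ} = εN`, compare coordinates), so `r ≤ dim_K {m(0) | m ∈ N}`. Hence if
every `m(0)`, `m ∈ N`, lay in `t(A^*)` we would get `bR(t) = r ≤ dim t(A^*)`.

## Not here

The torus / Borel-fixed refinement (Jagiełła–Jelisiejew Thm. 1.8: it suffices to test extension
directions fixed by a Borel subgroup of the stabiliser) needs Zariski-closedness of
`{bR ≤ r}` over an algebraically closed field and is NOT in this file; neither are the per-tensor
certificates. HONEST FRAMING (pub-tensor bundle): this file is an elementary LEMMA about border
rank used to certify lower bounds for specific small tensors — a THEOREM-level library item, NOT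
progress on the matrix multiplication exponent.

## References

* J. Jagiełła, J. Jelisiejew, *Unrestrictions and concise secant varieties*, arXiv:2604.24879
  (2026), Thm. 2.2, Lemma 2.7, Thm. 1.8.
* M. Bläser, *Fast Matrix Multiplication*, Theory of Computing Graduate Surveys 5 (2013), Def. 6.1.
-/

noncomputable section

open scoped BigOperators Polynomial

namespace Literature.Computability.AlgebraicComplexity

universe u v₁ v₂ v₃

/-! ## Saturation of a submodule by the powers of one scalar -/

section Sat

variable {R : Type*} [CommSemiring R] {M : Type*} [AddCommMonoid M] [Module R M]

/-- The saturation `{m | ∃ k, x^k • m ∈ P}` of a submodule `P` with respect to the powers of one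
scalar `x` (used for `R = K[ε]`, `x = ε`: all `m` with `ε^k m ∈ P` for some `k`). [folklore] -/
def satPow (x : R) (P : Submodule R M) : Submodule R M where
  carrier := {m | ∃ k : ℕ, x ^ k • m ∈ P}
  zero_mem' := ⟨0, by simp⟩
  add_mem' := by
    rintro m m' ⟨k, hk⟩ ⟨l, hl⟩
    refine ⟨k + l, ?_⟩
    rw [smul_add]
    refine P.add_mem ?_ ?_
    · rw [pow_add, mul_comm, mul_smul]
      exact P.smul_mem _ hk
    · rw [pow_add, mul_smul]
      exact P.smul_mem _ hl
  smul_mem' := by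
    rintro c m ⟨k, hk⟩
    refine ⟨k, ?_⟩
    rw [smul_comm]
    exact P.smul_mem c hk

/-- Membership in the saturation `satPow x P`. [folklore] -/
theorem mem_satPow {x : R} {P : Submodule R M} {m : M} :
    m ∈ satPow x P ↔ ∃ k : ℕ, x ^ k • m ∈ P :=
  Iff.rfl

/-- `P ≤ satPow x P` (`k = 0`). [folklore] -/
theorem le_satPow (x : R) (P : Submodule R M) : P ≤ satPow x P :=
  fun _ hm => ⟨0, by simpa using hm⟩

end Sat

/-! ## Extending a tensor by one slice along the first factor -/

section ExtendDef

variable {K : Type u} {ι : Type v₁} {κ : Type v₂} {μ : Type v₃}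

/-- The tensor `t + e_new ⊗ Z ∈ K^{(ι ⊕ {new}) × κ × μ}`: `t` extended by one new slice `Z` along the
first factor (index type `Option ι`, the new index being `none`). [folklore] -/
def extendSlice (t : ι → κ → μ → K) (Z : κ → μ → K) : Option ι → κ → μ → K :=
  fun a => a.elim Z t

/-- The new slice of `extendSlice t Z` is `Z`. [folklore] -/
@[simp] theorem extendSlice_none (t : ι → κ → μ → K) (Z : κ → μ → K) :
    extendSlice t Z none = Z := rfl

/-- The old slices of `extendSlice t Z` are those of `t`. [folklore] -/
@[simp] theorem extendSlice_some (t : ι → κ → μ → K) (Z : κ → μ → K) (a : ι) :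
    extendSlice t Z (some a) = t a := rfl

end ExtendDef

section Field

variable {K : Type u} [Field K] {ι : Type v₁} {κ : Type v₂} {μ : Type v₃}

/-- The slice space `t(A^*) = ⟨t(a,·,·) : a ∈ ι⟩ ⊆ K^{κ × μ}` of `t` along the first factor.
[folklore] -/
abbrev sliceSpan (t : ι → κ → μ → K) : Submodule K (κ → μ → K) :=
  Submodule.span K (Set.range t)

/-! ## One extension per element of the saturated span of the `v_ρ ⊗ w_ρ` -/

/-- If `∑_ρ u_ρ ⊗ v_ρ ⊗ w_ρ = ε^h t + O(ε^{h+1})` and `ε^k m = ∑_ρ c_ρ (v_ρ ⊗ w_ρ)` over `K[ε]`,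
then the same `r` pairs `(v_ρ, w_ρ)` with first vectors `ε^h c_ρ e_new + ε^k u_ρ` form an
order-`(h+k)` approximate decomposition of `t + e_new ⊗ m(0)`. (Jagiełła–Jelisiejew 2026, proof of
Lemma 2.7, Segre case; elementary.) [cite: JagiellaJelisiejew2026Unrestrictions, Lemma 2.7 (proof)] -/
theorem IsApproxDecomposition.extendSlice {h : ℕ} {t : ι → κ → μ → K} {r : ℕ}
    {u : Fin r → ι → K[X]} {v : Fin r → κ → K[X]} {w : Fin r → μ → K[X]}
    (hd : IsApproxDecomposition h t u v w) {m : κ → μ → K[X]} {k : ℕ} {c : Fin r → K[X]}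
    (hm : ∑ ρ, c ρ • (fun b d => v ρ b * w ρ d : κ → μ → K[X]) = (Polynomial.X : K[X]) ^ k • m) :
    IsApproxDecomposition (h + k) (extendSlice t fun b d => (m b d).coeff 0)
      (fun ρ a => a.elim (Polynomial.X ^ h * c ρ) fun a' => Polynomial.X ^ k * u ρ a') v w := by
  rw [isApproxDecomposition_iff] at hd ⊢
  rintro (_ | a) b d
  · refine ⟨m b d, ?_, rfl⟩
    have e := congr_fun (congr_fun hm b) d
    simp only [Finset.sum_apply, Pi.smul_apply, smul_eq_mul] at e
    simp only [Option.elim_none]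
    calc ∑ ρ, Polynomial.X ^ h * c ρ * v ρ b * w ρ d
        = Polynomial.X ^ h * ∑ ρ, c ρ * (v ρ b * w ρ d) := by
          rw [Finset.mul_sum]
          exact Finset.sum_congr rfl fun ρ _ => by ring
      _ = Polynomial.X ^ (h + k) * m b d := by rw [e, pow_add]; ring
  · obtain ⟨Q, hQ, hQ0⟩ := hd a b d
    refine ⟨Q, ?_, by simpa using hQ0⟩
    simp only [Option.elim_some]
    calc ∑ ρ, Polynomial.X ^ k * u ρ a * v ρ b * w ρ d
        = Polynomial.X ^ k * ∑ ρ, u ρ a * v ρ b * w ρ d := by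
          rw [Finset.mul_sum]
          exact Finset.sum_congr rfl fun ρ _ => by ring
      _ = Polynomial.X ^ (h + k) * Q := by rw [hQ, pow_add]; ring

/-! ## In an optimal decomposition the matrices `v_ρ ⊗ w_ρ` are `K[ε]`-independent -/

/-- If `∑_{ρ<r} u_ρ ⊗ v_ρ ⊗ w_ρ = ε^h t + O(ε^{h+1})` with `r ≤ bR(t)` (an optimal approximate
decomposition), then the `r` matrices `v_ρ ⊗ w_ρ ∈ K[ε]^{κ × μ}` are linearly independent over
`K[ε]`: otherwise a relation `∑ g_ρ (v_ρ ⊗ w_ρ) = 0`, divided by the largest `ε^o` dividing every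
`g_ρ`, has some `g_{ρ₀}(0) ≠ 0`, and `g_{ρ₀} · ∑_ρ u_ρ ⊗ v_ρ ⊗ w_ρ` rewritten without the triad `ρ₀`
and rescaled by `g_{ρ₀}(0)⁻¹` is an order-`h` decomposition with `r - 1` triads. [folklore] -/
theorem linearIndependent_of_isApproxDecomposition {h : ℕ} {t : ι → κ → μ → K} {r : ℕ}
    {u : Fin r → ι → K[X]} {v : Fin r → κ → K[X]} {w : Fin r → μ → K[X]}
    (hd : IsApproxDecomposition h t u v w) (hr : r ≤ algBorderRank t) :
    LinearIndependent K[X] (fun ρ => fun b d => v ρ b * w ρ d : Fin r → κ → μ → K[X]) := by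
  classical
  by_contra hdep
  obtain ⟨g, hg, ρ₁, hρ₁⟩ := Fintype.not_linearIndependent_iff.1 hdep
  -- the lowest order `o` occurring in the relation, attained at `ρ₀`
  have hex : ∃ j, ∃ ρ, (g ρ).coeff j ≠ 0 := by
    by_contra hall
    push Not at hall
    exact hρ₁ (Polynomial.ext fun j => by rw [hall j ρ₁, Polynomial.coeff_zero])
  obtain ⟨ρ₀, hρ₀⟩ : ∃ ρ, (g ρ).coeff (Nat.find hex) ≠ 0 := Nat.find_spec hex
  have hlow : ∀ ρ, ∀ i < Nat.find hex, (g ρ).coeff i = 0 := fun ρ i hi => by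
    by_contra hc
    exact Nat.find_min hex hi ⟨ρ, hc⟩
  have hdvd : ∀ ρ, ∃ q : K[X], g ρ = Polynomial.X ^ Nat.find hex * q := fun ρ =>
    Polynomial.X_pow_dvd_iff.2 (hlow ρ)
  choose g' hg' using hdvd
  have hlc : (g' ρ₀).coeff 0 ≠ 0 := by
    rw [hg' ρ₀, Polynomial.coeff_X_pow_mul', if_pos le_rfl, Nat.sub_self] at hρ₀
    exact hρ₀
  -- the relation divided by `ε^o`, entrywise
  have hdep' : ∀ b d, ∑ ρ, g' ρ * (v ρ b * w ρ d) = 0 := by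
    intro b d
    have e := congr_fun (congr_fun hg b) d
    simp only [Finset.sum_apply, Pi.smul_apply, smul_eq_mul, Pi.zero_apply] at e
    have e2 : (Polynomial.X : K[X]) ^ Nat.find hex * ∑ ρ, g' ρ * (v ρ b * w ρ d) = 0 := by
      rw [Finset.mul_sum, ← e]
      exact Finset.sum_congr rfl fun ρ _ => by rw [hg' ρ]; ring
    exact (mul_eq_zero.1 e2).resolve_left (pow_ne_zero _ Polynomial.X_ne_zero)
  obtain ⟨r', rfl⟩ : ∃ r', r = r' + 1 := ⟨r - 1, by have := ρ₀.is_lt; omega⟩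
  -- eliminate the triad `ρ₀`
  have hd' : IsApproxDecomposition h t
      (fun i a => Polynomial.C ((g' ρ₀).coeff 0)⁻¹ *
        (g' ρ₀ * u (ρ₀.succAbove i) a - u ρ₀ a * g' (ρ₀.succAbove i)))
      (fun i => v (ρ₀.succAbove i)) (fun i => w (ρ₀.succAbove i)) := by
    rw [isApproxDecomposition_iff] at hd ⊢
    intro a b d
    obtain ⟨Q, hQ, hQ0⟩ := hd a b d
    refine ⟨Polynomial.C ((g' ρ₀).coeff 0)⁻¹ * g' ρ₀ * Q, ?_, ?_⟩
    · have e1 : Polynomial.X ^ h * Q = u ρ₀ a * v ρ₀ b * w ρ₀ d +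
          ∑ i : Fin r', u (ρ₀.succAbove i) a * v (ρ₀.succAbove i) b * w (ρ₀.succAbove i) d := by
        rw [← hQ]
        exact Fin.sum_univ_succAbove _ ρ₀
      have e2 : (0 : K[X]) = g' ρ₀ * (v ρ₀ b * w ρ₀ d) +
          ∑ i : Fin r', g' (ρ₀.succAbove i) * (v (ρ₀.succAbove i) b * w (ρ₀.succAbove i) d) := by
        rw [← hdep' b d]
        exact Fin.sum_univ_succAbove _ ρ₀
      have hS : (∑ i : Fin r', Polynomial.C ((g' ρ₀).coeff 0)⁻¹ *
            (g' ρ₀ * u (ρ₀.succAbove i) a - u ρ₀ a * g' (ρ₀.succAbove i)) *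
            v (ρ₀.succAbove i) b * w (ρ₀.succAbove i) d) =
          Polynomial.C ((g' ρ₀).coeff 0)⁻¹ *
            (g' ρ₀ * ∑ i : Fin r', u (ρ₀.succAbove i) a * v (ρ₀.succAbove i) b *
                w (ρ₀.succAbove i) d -
              u ρ₀ a * ∑ i : Fin r', g' (ρ₀.succAbove i) *
                (v (ρ₀.succAbove i) b * w (ρ₀.succAbove i) d)) := by
        rw [Finset.mul_sum, Finset.mul_sum, ← Finset.sum_sub_distrib, Finset.mul_sum]
        exact Finset.sum_congr rfl fun i _ => by ring
      rw [hS]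
      linear_combination (-(Polynomial.C ((g' ρ₀).coeff 0)⁻¹ * g' ρ₀)) * e1 +
        (Polynomial.C ((g' ρ₀).coeff 0)⁻¹ * u ρ₀ a) * e2
    · rw [Polynomial.mul_coeff_zero, Polynomial.mul_coeff_zero, Polynomial.coeff_C_zero, hQ0,
        inv_mul_cancel₀ hlc, one_mul]
  have h1 := approxRank_le_of_isApproxDecomposition hd'
  have h2 := algBorderRank_le_approxRank h t
  omega

/-! ## The constant terms of the saturation have dimension at least the rank -/

/-- Let `W_1, …, W_r ∈ K[ε]^{κ × μ}` be `K[ε]`-linearly independent and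
`N = {m | ∃ k, ε^k m ∈ ⟨W_ρ⟩_{K[ε]}}`. If the constant terms `m(0)` of all `m ∈ N` lie in a
subspace `V ⊆ K^{κ × μ}`, then `r ≤ dim_K V`: `N` is finitely generated and torsion-free over the
PID `K[ε]`, hence free of rank `n ≥ r`, and the constant terms of a basis of `N` are `K`-linearly
independent because `N ∩ ε K[ε]^{κ × μ} = ε N`. [folklore] -/
theorem le_finrank_of_linearIndependent_of_satPow [Fintype κ] [Fintype μ] {r : ℕ}
    {W : Fin r → κ → μ → K[X]} (hW : LinearIndependent K[X] W) (V : Submodule K (κ → μ → K))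
    (hV : ∀ m ∈ satPow (Polynomial.X : K[X]) (Submodule.span K[X] (Set.range W)),
      (fun b d => (m b d).coeff 0 : κ → μ → K) ∈ V) :
    r ≤ Module.finrank K V := by
  classical
  -- the saturation `N`, a free `K[ε]`-module of rank `n ≥ r`
  obtain ⟨n, bN⟩ := Module.basisOfFiniteTypeTorsionFree' (R := K[X])
    (M := ↥(satPow (Polynomial.X : K[X]) (Submodule.span K[X] (Set.range W))))
  have hWN : ∀ ρ, W ρ ∈ satPow (Polynomial.X : K[X]) (Submodule.span K[X] (Set.range W)) :=
    fun ρ => le_satPow _ _ (Submodule.subset_span ⟨ρ, rfl⟩)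
  have hli : LinearIndependent K[X] (fun ρ => (⟨W ρ, hWN ρ⟩ :
      ↥(satPow (Polynomial.X : K[X]) (Submodule.span K[X] (Set.range W))))) :=
    LinearIndependent.of_comp (Submodule.subtype _) (by exact hW)
  have hrn : r ≤ n := by
    have := hli.fintype_card_le_finrank
    rwa [Module.finrank_eq_card_basis bN, Fintype.card_fin, Fintype.card_fin] at this
  -- the constant terms of the basis are `K`-linearly independent
  let f : Fin n → κ → μ → K := fun i b d => ((bN i : _) : κ → μ → K[X]) b d |>.coeff 0
  have hf : LinearIndependent K f := by
    rw [Fintype.linearIndependent_iff]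
    intro g hg i
    -- `m = ∑ g_j bN_j ∈ N` has vanishing constant terms
    let mN : ↥(satPow (Polynomial.X : K[X]) (Submodule.span K[X] (Set.range W))) :=
      ∑ j, Polynomial.C (g j) • bN j
    have hm0 : ∀ b d, ((mN : κ → μ → K[X]) b d).coeff 0 = 0 := by
      intro b d
      have e := congr_fun (congr_fun hg b) d
      simp only [Finset.sum_apply, Pi.smul_apply, smul_eq_mul, Pi.zero_apply, f] at e
      simp only [mN, Submodule.coe_sum, Submodule.coe_smul, Finset.sum_apply, Pi.smul_apply,
        smul_eq_mul, Polynomial.finsetSum_coeff, Polynomial.coeff_C_mul]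
      exact e
    -- hence `m = ε • m₂` with `m₂ ∈ N` (saturation)
    let m₂ : κ → μ → K[X] := fun b d => ((mN : κ → μ → K[X]) b d).divX
    have hXm₂ : (Polynomial.X : K[X]) • m₂ = (mN : κ → μ → K[X]) := by
      funext b d
      have e := Polynomial.X_mul_divX_add ((mN : κ → μ → K[X]) b d)
      rw [hm0 b d, map_zero, add_zero] at e
      exact e
    have hm₂N : m₂ ∈ satPow (Polynomial.X : K[X]) (Submodule.span K[X] (Set.range W)) := by
      obtain ⟨k, hk⟩ := mem_satPow.1 mN.2
      refine mem_satPow.2 ⟨k + 1, ?_⟩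
      rw [pow_succ, mul_smul, hXm₂]
      exact hk
    -- compare coordinates: `C (g i) = ε * (coordinate of m₂)`
    have hc1 : bN.equivFun mN = fun j => Polynomial.C (g j) := by
      symm
      rw [← LinearEquiv.symm_apply_eq, bN.equivFun_symm_apply]
    have hc2 : bN.equivFun mN = (Polynomial.X : K[X]) • bN.equivFun ⟨m₂, hm₂N⟩ := by
      rw [← map_smul]
      congr 1
      apply Subtype.ext
      rw [Submodule.coe_smul]
      exact hXm₂.symm
    have e3 := congr_fun (hc1.symm.trans hc2) i
    simp only [Pi.smul_apply, smul_eq_mul] at e3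
    have e4 := congr_arg (fun p : K[X] => p.coeff 0) e3
    simpa only [Polynomial.coeff_C_zero, Polynomial.coeff_X_mul_zero] using e4
  have hfV : Submodule.span K (Set.range f) ≤ V :=
    Submodule.span_le.2 (by
      rintro _ ⟨i, rfl⟩
      exact hV _ (bN i).2)
  calc r ≤ n := hrn
    _ = Module.finrank K (Submodule.span K (Set.range f)) := by
        rw [finrank_span_eq_card hf, Fintype.card_fin]
    _ ≤ Module.finrank K V := Submodule.finrank_mono hfV

/-! ## The extension theorem and its contrapositive -/

variable [Fintype ι] [Fintype κ] [Fintype μ] [DecidableEq ι] [DecidableEq κ] [DecidableEq μ]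

/-- Extending by a slice does not decrease the border rank: `bR(t) ≤ bR(t + e_new ⊗ Z)` (`t` is the
restriction of the extension to the old indices). [folklore] -/
theorem algBorderRank_le_extendSlice (t : ι → κ → μ → K) (Z : κ → μ → K) :
    algBorderRank t ≤ algBorderRank (extendSlice t Z) :=
  algBorderRank_precomp_le (extendSlice t Z) some id id

/-- **One-step unrestriction preserving the border rank.** If the slices `t(a,·,·)` of
`t ∈ K^{ι × κ × μ}` span a subspace `t(A^*)` of dimension `< bR(t)`, then some `Z ∉ t(A^*)`
satisfies `bR(t + e_new ⊗ Z) ≤ bR(t)` (hence `=`). Any field `K`; `bR` = Bläser's algebraic border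
rank over `K[ε]`. (Jagiełła–Jelisiejew 2026, Thm. 2.2 via Lemma 2.7, Segre case, one variable; the
Segre case credited there to Buczyński.) [cite: JagiellaJelisiejew2026Unrestrictions, Thm. 2.2] -/
theorem exists_extendSlice_of_finrank_sliceSpan_lt (t : ι → κ → μ → K)
    (ht : Module.finrank K (sliceSpan t) < algBorderRank t) :
    ∃ Z : κ → μ → K, Z ∉ sliceSpan t ∧ algBorderRank (extendSlice t Z) ≤ algBorderRank t := by
  classical
  obtain ⟨h, hh⟩ := exists_algBorderRank_eq_approxRank t
  obtain ⟨u, v, w, hd⟩ := exists_isApproxDecomposition_approxRank h t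
  have hW := linearIndependent_of_isApproxDecomposition hd hh.symm.le
  by_contra hne
  push Not at hne
  have hsat : ∀ m ∈ satPow (Polynomial.X : K[X])
      (Submodule.span K[X] (Set.range fun ρ => fun b d => v ρ b * w ρ d)),
      (fun b d => (m b d).coeff 0 : κ → μ → K) ∈ sliceSpan t := by
    intro m hm
    by_contra hnot
    obtain ⟨k, hk⟩ := mem_satPow.1 hm
    obtain ⟨c, hc⟩ := (Submodule.mem_span_range_iff_exists_fun K[X]).1 hk
    have hle := (algBorderRank_le_approxRank (h + k) _).trans
      (approxRank_le_of_isApproxDecomposition (hd.extendSlice hc))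
    rw [← hh] at hle
    exact (hne _ hnot).not_ge hle
  have hfin := le_finrank_of_linearIndependent_of_satPow hW (sliceSpan t) hsat
  rw [← hh] at hfin
  exact (not_le.2 ht) hfin

/-- **Extension-search lower bound (contrapositive).** If `dim t(A^*) < r ≤ bR(t)` and every
extension `t + e_new ⊗ Z` by a slice `Z ∉ t(A^*)` has border rank `> r`, then `bR(t) > r`.
[cite: JagiellaJelisiejew2026Unrestrictions, Thm. 2.2] -/
theorem lt_algBorderRank_of_forall_extendSlice (t : ι → κ → μ → K) {r : ℕ}
    (hVr : Module.finrank K (sliceSpan t) < r) (hr : r ≤ algBorderRank t)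
    (H : ∀ Z : κ → μ → K, Z ∉ sliceSpan t → r < algBorderRank (extendSlice t Z)) :
    r < algBorderRank t := by
  refine lt_of_le_of_ne hr fun hrt => ?_
  obtain ⟨Z, hZ, hle⟩ := exists_extendSlice_of_finrank_sliceSpan_lt t (hVr.trans_le hr)
  exact (H Z hZ).not_ge (hle.trans hrt.symm.le)

/-- The same with the slice-count hypothesis `|ι| < r` (as in the certificates: a tensor with
`|ι|` slices and `bR(t) ≥ r > |ι|`). [cite: JagiellaJelisiejew2026Unrestrictions, Thm. 2.2] -/
theorem lt_algBorderRank_of_card_lt_of_forall_extendSlice (t : ι → κ → μ → K) {r : ℕ}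
    (hcard : Fintype.card ι < r) (hr : r ≤ algBorderRank t)
    (H : ∀ Z : κ → μ → K, Z ∉ sliceSpan t → r < algBorderRank (extendSlice t Z)) :
    r < algBorderRank t :=
  lt_algBorderRank_of_forall_extendSlice t ((finrank_range_le_card t).trans_lt hcard) hr H

/-! ## The extension's border rank depends on `Z` only modulo `t(A^*)` and scalars -/

/-- `bR(t + e_new ⊗ (l Z + ∑ c_a t_a)) ≤ bR(t + e_new ⊗ Z)`: the left tensor is a restriction of the
right one (a change of basis in the first factor). [folklore] -/
theorem algBorderRank_extendSlice_congr_le (t : ι → κ → μ → K) (Z : κ → μ → K) (c : ι → K)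
    (l : K) :
    algBorderRank (extendSlice t (l • Z + ∑ a, c a • t a)) ≤ algBorderRank (extendSlice t Z) := by
  classical
  let A : Option ι → Option ι → K := fun a' a =>
    a'.elim (a.elim l c) fun x => a.elim 0 fun y => if y = x then 1 else 0
  have hA : extendSlice t (l • Z + ∑ a, c a • t a) =
      fun a' b d => ∑ a, A a' a * extendSlice t Z a b d := by
    funext a' b d
    rw [Fintype.sum_option]
    rcases a' with _ | x
    · simp [A, extendSlice, Finset.sum_apply]
    · simp [A, extendSlice]
  rw [hA]
  exact algBorderRank_restrict₁_le (extendSlice t Z) A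

/-- `bR(t + e_new ⊗ (l Z + ∑ c_a t_a)) = bR(t + e_new ⊗ Z)` for `l ≠ 0`: the extension's border
rank is a function of the line of `Z` in `K^{κ × μ} / t(A^*)`. [folklore] -/
theorem algBorderRank_extendSlice_congr (t : ι → κ → μ → K) (Z : κ → μ → K) (c : ι → K)
    {l : K} (hl : l ≠ 0) :
    algBorderRank (extendSlice t (l • Z + ∑ a, c a • t a)) = algBorderRank (extendSlice t Z) := by
  refine le_antisymm (algBorderRank_extendSlice_congr_le t Z c l) ?_
  have key := algBorderRank_extendSlice_congr_le t (l • Z + ∑ a, c a • t a)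
    (fun a => -(l⁻¹ * c a)) l⁻¹
  have hsum : ∑ a, (l⁻¹ • c a • t a + (-(l⁻¹ * c a)) • t a) = 0 :=
    Finset.sum_eq_zero fun a _ => by rw [smul_smul, neg_smul, add_neg_cancel]
  have hZ : l⁻¹ • (l • Z + ∑ a, c a • t a) + ∑ a, (-(l⁻¹ * c a)) • t a = Z := by
    rw [smul_add, smul_smul, inv_mul_cancel₀ hl, one_smul, Finset.smul_sum, add_assoc,
      ← Finset.sum_add_distrib, hsum, add_zero]
  rwa [hZ] at key

end Field

end Literature.Computability.AlgebraicComplexity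

end
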